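import Literature.AnabelianGeometry.EtaleTheta.Discharge.Sec2Prop214iiOfSetting
import Literature.AnabelianGeometry.EtaleTheta.Discharge.Sec2DeltaThetaTorsionFree
import HarnessLib

/-!
# [EtTh] Prop 2.14 (ii) / Cor 2.18 (ii) for the §1 model at ONE level, under the freeness guard
# (proof-only corollary of "`Δ_Θ` is torsion-free")

Mochizuki, *The étale theta function …* [EtTh], Publ. RIMS **45** (2009), §2, Prop. 2.14 (ii) (PRIMS PDF
p. 49) and Cor. 2.18 (ii) (p. 59) [cite: MochizukiEtTh2009, Prop 2.14 (ii) p.49]. Layer L2 of the abc-iut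
cell, seat abc-iut-L2-t8 (gen 2); PROOF-ONLY capstone over `Discharge/Sec2Prop214iiOfSetting.lean`
(seat abc-iut-L2-t10: `rigidData_prop214_ii_of_H2` / `rigidData_cor218_ii_of_H2`, conditional on the
`2`-torsion hypothesis `H2` of the level-`N` cyclotome) and `Discharge/Sec2DeltaThetaTorsionFree.lean`
(`CyclotomeMod.red_eq_one_of_sq_eq_one_of_origin`: `H2` holds for EVERY single-level cyclotome under the
guard `IsEtThOrigin`). Result: Prop. 2.14 (ii) and Cor. 2.18 (ii) hold for t8's `C.rigidData μ hC hS h15 L`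
at ANY single level `N` — no compatible tower needed — modulo exactly {Prop 1.5 (ii), (iii) as named
facts, `IsEtThOrigin`}. One-line bodies; nothing of another seat is edited or restated. HONEST FRAMING:
kernel checks of printed reductions; the named §1 facts are not discharged; no side taken on [IUTchIII]
Cor. 3.12.
-/

noncomputable section

namespace Literature.AnabelianGeometry.EtaleTheta

namespace ThetaSetting

namespace EtaleThetaData.DoubleUnderline

variable {p : ℕ} [Fact p.Prime] {D : ThetaSetting p} {E : D.EtaleThetaData} {l : ℕ}
  (C : E.DoubleUnderline l) {N : ℕ+} (μ : D.CyclotomeMod l N)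

/-- **[EtTh] Prop. 2.14 (ii) for the §1 model at one level, under the guard**: for EVERY level-`N`
identification `μ` (no tower), modulo Prop 1.5 (ii), (iii) and `IsEtThOrigin` (the `2`-torsion hypothesis
`H2` of abc-iut-L2-t10 being a theorem under the guard). [cite: MochizukiEtTh2009, Prop 2.14 (ii) p.49] -/
theorem rigidData_prop214_ii_of_origin (hC : D.Compat) (hS : D.Sec2Hyps) (h15 : Prop15iii E hC)
    (h15ii : Prop15ii E.toKummerData hC) (L : C.CuspLabels) (hO : D.IsEtThOrigin) :
    (C.rigidData μ hC hS h15 L).Prop214_ii :=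
  C.rigidData_prop214_ii_of_H2 μ hC hS h15 h15ii L fun t ht => μ.red_eq_one_of_sq_eq_one_of_origin D hO t ht

/-- **[EtTh] Cor. 2.18 (ii) for the §1 model at one level, under the guard** (same hypotheses).
[cite: MochizukiEtTh2009, Cor 2.18 (ii) p.59] -/
theorem rigidData_cor218_ii_of_origin (hC : D.Compat) (hS : D.Sec2Hyps) (h15 : Prop15iii E hC)
    (h15ii : Prop15ii E.toKummerData hC) (L : C.CuspLabels) (hO : D.IsEtThOrigin) :
    (C.rigidData μ hC hS h15 L).Cor218_ii :=
  C.rigidData_cor218_ii_of_H2 μ hC hS h15 h15ii L fun t ht => μ.red_eq_one_of_sq_eq_one_of_origin D hO t ht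

end EtaleThetaData.DoubleUnderline

end ThetaSetting

end Literature.AnabelianGeometry.EtaleTheta

end
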